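import Literature.Analysis.FluidPDE.NormalisedPressureIsometry
import Literature.Analysis.FluidPDE.AxisymmetricVorticityTransport
import HarnessLib

/-!
# The pressure function of an axisymmetric field is axisymmetric

Analysis/FluidPDE support file (one corollary of the accepted `NormalisedPressureIsometry`;
serves the decomposition of the barrier fact
`Literature.Barriers.NavierStokesRegularity.NSIBlockExists`, Scheffer 1985 / Ożański 2017):
for the normalised (Riesz-transform) pressure `p̃[u] = -Δ⁻¹∂ᵢ∂ⱼ(uᵢuⱼ)` of the accepted
`NormalisedPressure.lean` and EVERY field `u : ℝ³ → ℝ³` that is axisymmetric about the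
`x 2`-axis (`Fluid.IsAxisymmetric`: `u (R_θ x) = R_θ (u x)`), the scalar `p̃[u]` is axisymmetric
(`Fluid.IsAxisymmetricScalar`: `p̃[u](R_θ x) = p̃[u](x)`) — Ożański, arXiv:1709.00602v4, §3.2,
(3.8): "the pressure function corresponding to an axisymmetric vector field is axisymmetric"
(printed for `u ∈ C_c^∞`; here for every `u`, the junk branch of `normalisedPressure` being
covariant as well). Proof: `normalisedPressure_comp_linearIsometryEquiv_of_equivariant` with
the rotation `rotZLIE θ`.

## References

* W. S. Ożański, *On weak solutions to the Navier–Stokes inequality with internal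
  singularities*, arXiv:1709.00602v4, §3.2 (3.8). [`Ozanski2017NSISingular`] (The held
  plain-text rendering of the paper carries equation labels rather than the PDF numbers.)
-/

noncomputable section

namespace Literature.Analysis.FluidPDE

/-- **The pressure function of an axisymmetric field is an axisymmetric scalar**:
`p̃[u](R_θ x) = p̃[u](x)` for every `θ`, `x` (Ożański 2017, (3.8), there for `u ∈ C_c^∞(ℝ³)`; here
for every `u : ℝ³ → ℝ³`). [cite: Ozanski2017NSISingular, §3.2 (3.8)] -/
theorem IsAxisymmetric.isAxisymmetricScalar_normalisedPressure
    {u : EuclideanSpace ℝ (Fin 3) → EuclideanSpace ℝ (Fin 3)} (hu : IsAxisymmetric u) :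
    IsAxisymmetricScalar (normalisedPressure u) := fun θ x =>
  normalisedPressure_comp_linearIsometryEquiv_of_equivariant (rotZLIE θ) (hu θ) x

end Literature.Analysis.FluidPDE

end
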